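/-
Copyright (c) 2026 the pub-hodgecm-mathlib formalisation cell (harness21).  Prover seat hodgecm-mathlib-LD1-p02 (g4), FLOOR 0, programme P6,
half-A line LD1 of crux `hLiu418`, brick (Gα-C∞) `ArchLadder`, plate (P4) «ι-step», sub-brick (P4b) generic half.  KERNEL module: THEOREMS ONLY
(no definition, no named fact, no `sorry`, no instance, no notation).
-/
import Literature.NumberTheory.Weil1964.ArchUnitaryWeilHalfCompact
import HarnessLib

/-!
# A family of place components that is a boost of ONE hyperbolic plane at ONE place assembles, under `UForm.placeDiag`, to the boost `hypV`
# of the big junction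

Topic `NumberTheory/Weil1964`; namespace `Literature.NumberTheory.Weil1964`.  KERNEL ONLY: proved theorems; 0 definitions, 0 records, 0 `sorry`.

Setting of ★ `ArchPlaceUnitaryDiagonal` ∕ ★ `ArchUnitaryWeilHalfCompact` §2: finitely many places `v : o`, sign vectors `x v : Fin m → ℝ`, sign frames
`signSplit (x v) : Fin m ≃ PosIdx (x v) ⊕ NegIdx (x v)`, the block assembly `UForm.placeDiag : (Π_v U(Pos_v, Neg_v)) →* U(Σ_v Pos_v, Σ_v Neg_v)`.
The sibling ★ `placeDiag_kV` treats SIGN-BLOCK COMPACT families; here the family is the identity at every place `v ≠ v₀` and, at `v₀`, the identity off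
ONE hyperbolic plane `{jp, jm}` (`jp` positive, `jm` negative) on which it is the `SU(1,1)`-boost `!![ch t, −i sh t; i sh t, ch t]` (entries read in the
sign frame):

* **`UForm.placeDiag_eq_hypV_of_entries`** — then `placeDiag G = hypV ⟨v₀, jp⟩ ⟨v₀, jm⟩ t`, the boost ★ `RealDualPair.hypV` of the big junction
  `U(Σ_v Pos_v, Σ_v Neg_v)` planted at the pair of indices `(⟨v₀, jp⟩, ⟨v₀, jm⟩)`.

This is the index bookkeeping under which the archimedean section of a number-field unitary group at a NON-compact one-place element (the boost of
a hyperbolic plane at an indefinite place) is read through the junction's hyperbolic family (★ `JunctionHyperbolicFamily.hypOp`, ★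
`JunctionHyperbolicHermiteLadder`) — the «ι-step» of brick (Gα-C∞) `ArchLadder` of line LD1 (crux `hLiu418`, cell hodgecm-mathlib).  Nothing of
[Liu2021] is asserted; HC_CM is NOT proved here or anywhere in the tree.

## References
* [Weil1964] A. Weil, Acta Math. 111 (1964), Chap. III n° 37 (archimedean places, product decomposition).
* [KonnoKonno2007] K. Konno, T. Konno, Kyushu J. Math. 61 (2007), §3.1 (3.1), §3.3 (the `KAK` middle factor; junction conventions).
* [Knapp2002] A. W. Knapp, *Lie Groups Beyond an Introduction*, 2nd ed. (2002), Thm. 7.39 (`KAK`).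
-/

set_option autoImplicit false

noncomputable section

open scoped Matrix ComplexConjugate
open Complex

namespace Literature.NumberTheory.Weil1964

open Literature.NumberTheory.Automorphic Literature.NumberTheory.Automorphic.UnitaryGroup
open Literature.RepresentationTheory.KonnoKonno2007 Literature.RepresentationTheory.KonnoKonno2007.RealDualPair

section PlaceDiagBoost

variable {o : Type} [Fintype o] [DecidableEq o] {m : ℕ} (x : o → Fin m → ℝ)

omit [Fintype o] [DecidableEq o] in
/-- equality of dependent pairs `⟨v, a⟩ = ⟨v₀, ⟨j₀, H⟩⟩` in `Σ v, {j // p v j}` is `v = v₀ ∧ a.1 = j₀`. [folklore] -/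
private theorem sigma_subtype_mk_eq_iff {p : o → Fin m → Prop} {v v₀ : o} (a : {j // p v j}) {j₀ : Fin m} (H : p v₀ j₀) :
    (⟨v, a⟩ : Σ w, {j // p w j}) = ⟨v₀, ⟨j₀, H⟩⟩ ↔ v = v₀ ∧ a.1 = j₀ := by
  constructor
  · intro h
    have hv : v = v₀ := congrArg Sigma.fst h
    subst hv
    rw [Sigma.mk.inj_iff, heq_iff_eq] at h
    exact ⟨rfl, congrArg Subtype.val h.2⟩
  · rintro ⟨hv, hj⟩
    subst hv
    have ha : a = ⟨j₀, H⟩ := Subtype.ext hj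
    subst ha
    rfl

omit [Fintype o] [DecidableEq o] in
/-- `⟨v, a'⟩ = ⟨v, a⟩` in a `Σ`-type over the same base point is `a' = a`. [folklore] -/
private theorem sigma_mk_eq_iff_same {T : o → Type} {v : o} (a' a : T v) : (⟨v, a'⟩ : Σ w, T w) = ⟨v, a⟩ ↔ a' = a := by
  rw [Sigma.mk.inj_iff, heq_iff_eq]
  exact ⟨fun h => h.2, fun h => ⟨rfl, h⟩⟩

omit [Fintype o] [DecidableEq o] in
/-- `signSplit x i = inl ⟨i, h⟩` for `0 < x i`. [folklore] -/
private theorem signSplit_of_pos {y : Fin m → ℝ} (a : PosIdx y) : signSplit y a.1 = Sum.inl a := by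
  rw [signSplit, Equiv.sumCompl_symm_apply_of_pos (p := fun j => 0 < y j) a.2]

omit [Fintype o] [DecidableEq o] in
/-- `signSplit x i = inr ⟨i, h⟩` for `¬ 0 < x i`. [folklore] -/
private theorem signSplit_of_neg {y : Fin m → ℝ} (b : NegIdx y) : signSplit y b.1 = Sum.inr b := by
  rw [signSplit, Equiv.sumCompl_symm_apply_of_neg (p := fun j => 0 < y j) b.2]

/-- **A ONE-PLANE BOOST AT ONE PLACE ASSEMBLES TO `hypV`.**  Let `G_v ∈ U(Pos_v, Neg_v)` (`v : o`) have, in the sign frames `signSplit (x v)`, the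
entries of the identity except at the place `v₀` on the plane `{jp, jm}` (`0 < x v₀ jp`, `¬ 0 < x v₀ jm`), where they are those of the boost
`!![ch t, −i sh t; i sh t, ch t]`.  Then `placeDiag G = hypV ⟨v₀, jp⟩ ⟨v₀, jm⟩ t` in `U(Σ_v Pos_v, Σ_v Neg_v)`.
[cite: KonnoKonno2007, §3.1 (3.1), §3.3] [cite: Weil1964, Chap. III n° 37] -/
theorem UForm.placeDiag_eq_hypV_of_entries (v₀ : o) (jp jm : Fin m) (Hp : 0 < x v₀ jp) (Hm : ¬0 < x v₀ jm) (t : ℝ)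
    (G : ∀ v, UForm (PosIdx (x v)) (NegIdx (x v)))
    (hG : ∀ (v : o) (j j' : Fin m), (v ≠ v₀ ∨ (j ≠ jp ∧ j ≠ jm) ∨ (j' ≠ jp ∧ j' ≠ jm)) →
      (((G v : UForm (PosIdx (x v)) (NegIdx (x v))) : GL (PosIdx (x v) ⊕ NegIdx (x v)) ℂ) :
          Matrix (PosIdx (x v) ⊕ NegIdx (x v)) (PosIdx (x v) ⊕ NegIdx (x v)) ℂ) (signSplit (x v) j) (signSplit (x v) j') =
        if j = j' then 1 else 0)
    (hpp : (((G v₀ : UForm (PosIdx (x v₀)) (NegIdx (x v₀))) : GL (PosIdx (x v₀) ⊕ NegIdx (x v₀)) ℂ) :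
          Matrix (PosIdx (x v₀) ⊕ NegIdx (x v₀)) (PosIdx (x v₀) ⊕ NegIdx (x v₀)) ℂ) (signSplit (x v₀) jp) (signSplit (x v₀) jp) =
        (Real.cosh t : ℂ))
    (hpm : (((G v₀ : UForm (PosIdx (x v₀)) (NegIdx (x v₀))) : GL (PosIdx (x v₀) ⊕ NegIdx (x v₀)) ℂ) :
          Matrix (PosIdx (x v₀) ⊕ NegIdx (x v₀)) (PosIdx (x v₀) ⊕ NegIdx (x v₀)) ℂ) (signSplit (x v₀) jp) (signSplit (x v₀) jm) =
        -(Real.sinh t : ℂ) * I)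
    (hmp : (((G v₀ : UForm (PosIdx (x v₀)) (NegIdx (x v₀))) : GL (PosIdx (x v₀) ⊕ NegIdx (x v₀)) ℂ) :
          Matrix (PosIdx (x v₀) ⊕ NegIdx (x v₀)) (PosIdx (x v₀) ⊕ NegIdx (x v₀)) ℂ) (signSplit (x v₀) jm) (signSplit (x v₀) jp) =
        (Real.sinh t : ℂ) * I)
    (hmm : (((G v₀ : UForm (PosIdx (x v₀)) (NegIdx (x v₀))) : GL (PosIdx (x v₀) ⊕ NegIdx (x v₀)) ℂ) :
          Matrix (PosIdx (x v₀) ⊕ NegIdx (x v₀)) (PosIdx (x v₀) ⊕ NegIdx (x v₀)) ℂ) (signSplit (x v₀) jm) (signSplit (x v₀) jm) =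
        (Real.cosh t : ℂ)) :
    UForm.placeDiag G =
      hypV (α := Σ v, PosIdx (x v)) (β := Σ v, NegIdx (x v)) ⟨v₀, ⟨jp, Hp⟩⟩ ⟨v₀, ⟨jm, Hm⟩⟩ t := by
  have eP : ∀ {v : o} (a : PosIdx (x v)), (⟨v, a⟩ : Σ w, PosIdx (x w)) = ⟨v₀, ⟨jp, Hp⟩⟩ ↔ v = v₀ ∧ a.1 = jp :=
    fun a => sigma_subtype_mk_eq_iff (p := fun w j => 0 < x w j) a Hp
  have eN : ∀ {v : o} (b : NegIdx (x v)), (⟨v, b⟩ : Σ w, NegIdx (x w)) = ⟨v₀, ⟨jm, Hm⟩⟩ ↔ v = v₀ ∧ b.1 = jm :=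
    fun b => sigma_subtype_mk_eq_iff (p := fun w j => ¬0 < x w j) b Hm
  apply Subtype.ext
  apply Units.ext
  rw [UForm.coe_placeDiag]
  ext X Y
  obtain ⟨⟨v, s⟩, rfl⟩ := (Equiv.sigmaSumDistrib (fun v => PosIdx (x v)) (fun v => NegIdx (x v))).surjective X
  obtain ⟨⟨w, s'⟩, rfl⟩ := (Equiv.sigmaSumDistrib (fun v => PosIdx (x v)) (fun v => NegIdx (x v))).surjective Y
  by_cases hvw : v = w
  · subst hvw
    rw [placeDiagMatrix_apply_same]
    rcases s with a | b <;> rcases s' with a' | b'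
    · -- (Pos, Pos)
      simp only [Equiv.sigmaSumDistrib_apply, Sum.map_inl]
      rw [hypV_inl_inl, ← signSplit_of_pos a, ← signSplit_of_pos a']
      split_ifs with h1 h2 h3
      · obtain ⟨hv, hap⟩ := (eP a).1 h1
        subst hv
        obtain ⟨-, hap'⟩ := (eP a').1 h2
        rw [hap, hap', hpp]
      · obtain ⟨hv, hap⟩ := (eP a).1 h1
        subst hv
        have hap' : a'.1 ≠ jp := fun h => h2 ((eP a').2 ⟨rfl, h⟩)
        have hajm' : a'.1 ≠ jm := fun h => Hm (by rw [← h]; exact a'.2)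
        rw [hG v a.1 a'.1 (Or.inr (Or.inr ⟨hap', hajm'⟩)), if_neg (fun h => hap' (h.symm.trans hap))]
      · have haa : a' = a := (sigma_mk_eq_iff_same (T := fun w => PosIdx (x w)) a' a).1 h3
        subst haa
        by_cases hv : v = v₀
        · subst hv
          have hap : a'.1 ≠ jp := fun h => h1 ((eP a').2 ⟨rfl, h⟩)
          have hajm : a'.1 ≠ jm := fun h => Hm (by rw [← h]; exact a'.2)
          rw [hG v a'.1 a'.1 (Or.inr (Or.inl ⟨hap, hajm⟩)), if_pos rfl]
        · rw [hG v a'.1 a'.1 (Or.inl hv), if_pos rfl]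
      · have haa : a.1 ≠ a'.1 := fun h => h3 ((sigma_mk_eq_iff_same (T := fun w => PosIdx (x w)) a' a).2 (Subtype.ext h.symm))
        by_cases hv : v = v₀
        · subst hv
          by_cases hap : a.1 = jp
          · exact absurd ((eP a).2 ⟨rfl, hap⟩) h1
          · have hajm : a.1 ≠ jm := fun h => Hm (by rw [← h]; exact a.2)
            rw [hG v a.1 a'.1 (Or.inr (Or.inl ⟨hap, hajm⟩)), if_neg haa]
        · rw [hG v a.1 a'.1 (Or.inl hv), if_neg haa]
    · -- (Pos, Neg)
      simp only [Equiv.sigmaSumDistrib_apply, Sum.map_inl, Sum.map_inr]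
      rw [hypV_inl_inr, ← signSplit_of_pos a, ← signSplit_of_neg b']
      have hab : a.1 ≠ b'.1 := fun h => b'.2 (by rw [← h]; exact a.2)
      split_ifs with h1
      · obtain ⟨hv, hap⟩ := (eP a).1 h1.1
        subst hv
        obtain ⟨-, hbm⟩ := (eN b').1 h1.2
        rw [hap, hbm, hpm]
      · by_cases hv : v = v₀
        · subst hv
          have hajm : a.1 ≠ jm := fun h => Hm (by rw [← h]; exact a.2)
          have hbjp : b'.1 ≠ jp := fun h => b'.2 (by rw [h]; exact Hp)
          by_cases hap : a.1 = jp
          · by_cases hbm : b'.1 = jm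
            · exact absurd ⟨(eP a).2 ⟨rfl, hap⟩, (eN b').2 ⟨rfl, hbm⟩⟩ h1
            · rw [hG v a.1 b'.1 (Or.inr (Or.inr ⟨hbjp, hbm⟩)), if_neg hab]
          · rw [hG v a.1 b'.1 (Or.inr (Or.inl ⟨hap, hajm⟩)), if_neg hab]
        · rw [hG v a.1 b'.1 (Or.inl hv), if_neg hab]
    · -- (Neg, Pos)
      simp only [Equiv.sigmaSumDistrib_apply, Sum.map_inl, Sum.map_inr]
      rw [hypV_inr_inl, ← signSplit_of_neg b, ← signSplit_of_pos a']
      have hba : b.1 ≠ a'.1 := fun h => b.2 (by rw [h]; exact a'.2)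
      split_ifs with h1
      · obtain ⟨hv, hbm⟩ := (eN b).1 h1.1
        subst hv
        obtain ⟨-, hap'⟩ := (eP a').1 h1.2
        rw [hbm, hap', hmp]
      · by_cases hv : v = v₀
        · subst hv
          have hbjp : b.1 ≠ jp := fun h => b.2 (by rw [h]; exact Hp)
          have hajm' : a'.1 ≠ jm := fun h => Hm (by rw [← h]; exact a'.2)
          by_cases hbm : b.1 = jm
          · by_cases hap' : a'.1 = jp
            · exact absurd ⟨(eN b).2 ⟨rfl, hbm⟩, (eP a').2 ⟨rfl, hap'⟩⟩ h1
            · rw [hG v b.1 a'.1 (Or.inr (Or.inr ⟨hap', hajm'⟩)), if_neg hba]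
          · rw [hG v b.1 a'.1 (Or.inr (Or.inl ⟨hbjp, hbm⟩)), if_neg hba]
        · rw [hG v b.1 a'.1 (Or.inl hv), if_neg hba]
    · -- (Neg, Neg)
      simp only [Equiv.sigmaSumDistrib_apply, Sum.map_inr]
      rw [hypV_inr_inr, ← signSplit_of_neg b, ← signSplit_of_neg b']
      split_ifs with h1 h2 h3
      · obtain ⟨hv, hbm⟩ := (eN b).1 h1
        subst hv
        obtain ⟨-, hbm'⟩ := (eN b').1 h2
        rw [hbm, hbm', hmm]
      · obtain ⟨hv, hbm⟩ := (eN b).1 h1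
        subst hv
        have hbm' : b'.1 ≠ jm := fun h => h2 ((eN b').2 ⟨rfl, h⟩)
        have hbjp' : b'.1 ≠ jp := fun h => b'.2 (by rw [h]; exact Hp)
        rw [hG v b.1 b'.1 (Or.inr (Or.inr ⟨hbjp', hbm'⟩)), if_neg (fun h => hbm' (h.symm.trans hbm))]
      · have hbb : b' = b := (sigma_mk_eq_iff_same (T := fun w => NegIdx (x w)) b' b).1 h3
        subst hbb
        by_cases hv : v = v₀
        · subst hv
          have hbm : b'.1 ≠ jm := fun h => h1 ((eN b').2 ⟨rfl, h⟩)
          have hbjp : b'.1 ≠ jp := fun h => b'.2 (by rw [h]; exact Hp)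
          rw [hG v b'.1 b'.1 (Or.inr (Or.inl ⟨hbjp, hbm⟩)), if_pos rfl]
        · rw [hG v b'.1 b'.1 (Or.inl hv), if_pos rfl]
      · have hbb : b.1 ≠ b'.1 := fun h => h3 ((sigma_mk_eq_iff_same (T := fun w => NegIdx (x w)) b' b).2 (Subtype.ext h.symm))
        by_cases hv : v = v₀
        · subst hv
          by_cases hbm : b.1 = jm
          · exact absurd ((eN b).2 ⟨rfl, hbm⟩) h1
          · have hbjp : b.1 ≠ jp := fun h => b.2 (by rw [h]; exact Hp)
            rw [hG v b.1 b'.1 (Or.inr (Or.inl ⟨hbjp, hbm⟩)), if_neg hbb]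
        · rw [hG v b.1 b'.1 (Or.inl hv), if_neg hbb]
  · rw [placeDiagMatrix_apply_ne _ hvw]
    rcases s with a | b <;> rcases s' with a' | b'
    · simp only [Equiv.sigmaSumDistrib_apply, Sum.map_inl]
      rw [hypV_inl_inl]
      split_ifs with h1 h2 h3
      · exact absurd ((congrArg Sigma.fst h1).trans (congrArg Sigma.fst h2).symm) hvw
      · rfl
      · exact absurd (congrArg Sigma.fst h3).symm hvw
      · rfl
    · simp only [Equiv.sigmaSumDistrib_apply, Sum.map_inl, Sum.map_inr]
      rw [hypV_inl_inr]
      split_ifs with h1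
      · exact absurd ((congrArg Sigma.fst h1.1).trans (congrArg Sigma.fst h1.2).symm) hvw
      · rfl
    · simp only [Equiv.sigmaSumDistrib_apply, Sum.map_inl, Sum.map_inr]
      rw [hypV_inr_inl]
      split_ifs with h1
      · exact absurd ((congrArg Sigma.fst h1.1).trans (congrArg Sigma.fst h1.2).symm) hvw
      · rfl
    · simp only [Equiv.sigmaSumDistrib_apply, Sum.map_inr]
      rw [hypV_inr_inr]
      split_ifs with h1 h2 h3
      · exact absurd ((congrArg Sigma.fst h1).trans (congrArg Sigma.fst h2).symm) hvw
      · rfl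
      · exact absurd (congrArg Sigma.fst h3).symm hvw
      · rfl

end PlaceDiagBoost

end Literature.NumberTheory.Weil1964

end
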